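import Summits.ValiantsHypothesis.ValiantsHypothesis.Theorems.BarrierLeverTransversalMinorLayoutsRankFive

/-!
# Route BarrierLever — conjecture TT (`TransversalMinorLayoutsNonsingular`, stmt-ValiantsHypothesis-19152):
# seven-face complexes without a vertex of degree one / of degree two

Helper file (`--supports stmt-ValiantsHypothesis-19152`; cell valiant-natproofs, rung V4, 𝒟-side of
door (c); seat val-np-p1 gen 8).  Partner classifications for the locked cells with seven faces of
the bounded engine (`FiniteCheck.tt_rank_le_of_lockedCore`): complexes with `< 8` faces are graphs
(`card_le_two_of_mem_lowerFamily`), and in membership form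

* `lowerFamily_seven_no_degree_one`: a lower family of seven sets in which no element lies in
  exactly one member is a MATCHING `∅, a, b, c, d, ab, cd` or a TRIANGLE `∅, a, b, c, ab, ac, bc`
  (the partner of a `6`-claw, cell `(6, 7)`, and — triangles only, matchings having a vertex of
  degree two — of a `5`-claw plus an edge, cell `(5, 7)`);
* (companion file `…SevenFacesNoDegTwo`: seven sets with a pair member and no element of degree
  two form a TRIANGLE — the partner of a perfect matching, cell `(4, 7)`).

Proofs: fix a pair member `{a, b}`; its four subsets are members; the members outside them are
singletons `{c}` (`c ∉ {a, b}`) or pairs containing such a `c`, and a `c` of degree `≠ 1` lies in an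
outside pair — two outside singletons and one outside pair give the matching, one outside singleton
and two outside pairs the triangle; with degrees `≠ 2`, `a` and `b` lie in second pairs `{a, c}`,
`{b, d}`, and counting members forces `c = d`.

WHAT THIS IS NOT: bookkeeping for bounded-rank slices of TT; nothing on TT / item 19761 in
general, on crux stmt-ValiantsHypothesis-14610, or on `VP` versus `VNP`.
-/

-- layout Summits/ValiantsHypothesis/ValiantsHypothesis forces the duplicated namespace component
set_option linter.dupNamespace false

open Matrix Finset

namespace Summit.ValiantsHypothesis.ValiantsHypothesis.Theorems.BarrierLever.FiniteCheck

open Summit.ValiantsHypothesis.ValiantsHypothesis.Theorems.BarrierLever.Compression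

/-! ## 1. The four subsets of a pair member -/

/-- The four subsets of a pair member `{a, b}` of a lower family are members, pairwise distinct,
and the singletons among them are `{a}`, `{b}`. -/
theorem pair_frame {h : ℕ} (F : Finset (Finset (Fin h))) (hlow : ∀ x ∈ F, ∀ t, t ⊆ x → t ∈ F)
    (a b : Fin h) (hab : a ≠ b) (hx : ({a, b} : Finset (Fin h)) ∈ F) :
    ({∅, {a}, {b}, {a, b}} : Finset (Finset (Fin h))) ⊆ F ∧
    ({∅, {a}, {b}, {a, b}} : Finset (Finset (Fin h))).card = 4 ∧
    (∀ e : Fin h, ({e} : Finset (Fin h)) ∈ ({∅, {a}, {b}, {a, b}} : Finset (Finset (Fin h))) →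
      e = a ∨ e = b) := by
  classical
  refine ⟨?_, ?_, ?_⟩
  · intro t ht
    simp only [Finset.mem_insert, Finset.mem_singleton] at ht
    rcases ht with rfl | rfl | rfl | rfl
    · exact hlow _ hx _ (Finset.empty_subset _)
    · exact hlow _ hx _ (by simp)
    · exact hlow _ hx _ (by simp)
    · exact hx
  · have h1 : (∅ : Finset (Fin h)) ∉ ({{a}, {b}, {a, b}} : Finset (Finset (Fin h))) := by
      simp only [Finset.mem_insert, Finset.mem_singleton, not_or]
      exact ⟨(Finset.singleton_ne_empty a).symm, (Finset.singleton_ne_empty b).symm,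
        fun e => by simpa using (e.symm ▸ Finset.mem_insert_self a {b} : a ∈ (∅ : Finset _))⟩
    have h2 : ({a} : Finset (Fin h)) ∉ ({{b}, {a, b}} : Finset (Finset (Fin h))) := by
      simp only [Finset.mem_insert, Finset.mem_singleton, not_or]
      refine ⟨fun e => hab (Finset.singleton_injective e), fun e => hab ?_⟩
      have : b ∈ ({a} : Finset (Fin h)) := by rw [e]; simp
      exact (Finset.mem_singleton.mp this).symm
    have h3 : ({b} : Finset (Fin h)) ≠ {a, b} := by
      intro e
      have : a ∈ ({b} : Finset (Fin h)) := by rw [e]; simp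
      exact hab (Finset.mem_singleton.mp this)
    rw [Finset.card_insert_of_notMem h1, Finset.card_insert_of_notMem h2, Finset.card_pair h3]
  · intro e he
    simp only [Finset.mem_insert, Finset.mem_singleton] at he
    rcases he with he | he | he | he
    · exact absurd he (Finset.singleton_ne_empty e)
    · exact Or.inl (Finset.singleton_injective he)
    · exact Or.inr (Finset.singleton_injective he)
    · exfalso
      have := congrArg Finset.card he
      rw [Finset.card_singleton, Finset.card_pair hab] at this
      omega

/-- In a lower family of fewer than `8` sets with at least two members... : if no element has
degree one, every singleton member lies in a pair member, and some member is a pair. -/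
theorem exists_pair_of_no_degree_one {h : ℕ} (F : Finset (Finset (Fin h)))
    (hlow : ∀ x ∈ F, ∀ t, t ⊆ x → t ∈ F) (hF8 : F.card < 8) (hF2 : 2 ≤ F.card)
    (hdeg : ∀ c : Fin h, (F.filter fun x => c ∈ x).card ≠ 1) :
    (∀ c : Fin h, ({c} : Finset (Fin h)) ∈ F → ∃ y ∈ F, c ∈ y ∧ y.card = 2) ∧
      ∃ x ∈ F, x.card = 2 := by
  classical
  have hle2 := card_le_two_of_mem_lowerFamily F hlow hF8
  have hpairOf : ∀ c : Fin h, ({c} : Finset (Fin h)) ∈ F → ∃ y ∈ F, c ∈ y ∧ y.card = 2 := by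
    intro c hc
    by_contra hno
    push Not at hno
    apply hdeg c
    rw [Finset.card_eq_one]
    refine ⟨{c}, Finset.eq_singleton_iff_unique_mem.mpr ⟨Finset.mem_filter.mpr ⟨hc, by simp⟩,
      fun y hy => ?_⟩⟩
    rw [Finset.mem_filter] at hy
    have hy2 := hno y hy.1 hy.2
    have hy1 : y.card ≤ 1 := by have := hle2 y hy.1; omega
    exact Finset.eq_singleton_iff_unique_mem.mpr ⟨hy.2, fun e he =>
      Finset.card_le_one.mp hy1 e he c hy.2⟩
  refine ⟨hpairOf, ?_⟩
  obtain ⟨x, hxF, hxne⟩ : ∃ x ∈ F, x ≠ ∅ := by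
    by_contra hno
    push Not at hno
    have : F ⊆ {∅} := fun x hx => Finset.mem_singleton.mpr (hno x hx)
    have := Finset.card_le_card this
    rw [Finset.card_singleton] at this
    omega
  obtain ⟨c, hc⟩ := Finset.nonempty_iff_ne_empty.mpr hxne
  obtain ⟨y, hyF, _, hy2⟩ := hpairOf c (hlow x hxF _ (Finset.singleton_subset_iff.mpr hc))
  exact ⟨y, hyF, hy2⟩

/-! ## 2. Seven faces without a vertex of degree one: matching or triangle -/

/-- A lower family of exactly seven sets in which no element lies in exactly one member is a
MATCHING `{∅, {a}, {b}, {c}, {d}, {a,b}, {c,d}}` or a TRIANGLE `{∅, {a}, {b}, {c}, {a,b}, {a,c},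
{b,c}}` (membership form). -/
theorem lowerFamily_seven_no_degree_one {h : ℕ} (F : Finset (Finset (Fin h)))
    (hlow : ∀ x ∈ F, ∀ t, t ⊆ x → t ∈ F) (hF : F.card = 7)
    (hdeg : ∀ c : Fin h, (F.filter fun x => c ∈ x).card ≠ 1) :
    (∃ a b c d : Fin h, a ≠ b ∧ a ≠ c ∧ a ≠ d ∧ b ≠ c ∧ b ≠ d ∧ c ≠ d ∧
      ({a} : Finset (Fin h)) ∈ F ∧ ({a, b} : Finset (Fin h)) ∈ F ∧
      ∀ y ∈ F, y = ∅ ∨ y = {a} ∨ y = {b} ∨ y = {c} ∨ y = {d} ∨ y = {a, b} ∨ y = {c, d}) ∨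
    (∃ a b c : Fin h, a ≠ b ∧ a ≠ c ∧ b ≠ c ∧
      ∀ y ∈ F, y = ∅ ∨ y = {a} ∨ y = {b} ∨ y = {c} ∨ y = {a, b} ∨ y = {a, c} ∨ y = {b, c}) := by
  classical
  have hle2 := card_le_two_of_mem_lowerFamily F hlow (by omega)
  obtain ⟨hpairOf, x, hxF, hx2⟩ := exists_pair_of_no_degree_one F hlow (by omega) (by omega) hdeg
  obtain ⟨a, b, hab, rfl⟩ := Finset.card_eq_two.mp hx2
  obtain ⟨hPF, hPcard, hsing⟩ := pair_frame F hlow a b hab hxF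
  set P : Finset (Finset (Fin h)) := {∅, {a}, {b}, {a, b}} with hPdef
  have hPmem : ∀ y, y ∈ P ↔ y = ∅ ∨ y = {a} ∨ y = {b} ∨ y = {a, b} := by
    intro y; simp only [hPdef, Finset.mem_insert, Finset.mem_singleton]
  -- the three members outside `P`
  have hdiff : (F \ P).card = 3 := by
    rw [Finset.card_sdiff_of_subset hPF, hF, hPcard]
  obtain ⟨f, g, k, hfg, hfk, hgk, hT⟩ := Finset.card_eq_three.mp hdiff
  have hmemT : ∀ y, (y ∈ F ∧ y ∉ P) ↔ (y = f ∨ y = g ∨ y = k) := by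
    intro y
    rw [← Finset.mem_sdiff, hT]
    simp only [Finset.mem_insert, Finset.mem_singleton]
  have hmemF : ∀ y, y ∈ F ↔ y = f ∨ y = g ∨ y = k ∨ y ∈ P := by
    intro y
    constructor
    · intro hy
      by_cases hyP : y ∈ P
      · exact Or.inr (Or.inr (Or.inr hyP))
      · rcases (hmemT y).mp ⟨hy, hyP⟩ with e | e | e
        · exact Or.inl e
        · exact Or.inr (Or.inl e)
        · exact Or.inr (Or.inr (Or.inl e))
    · rintro (e | e | e | hyP)
      · exact ((hmemT y).mpr (Or.inl e)).1
      · exact ((hmemT y).mpr (Or.inr (Or.inl e))).1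
      · exact ((hmemT y).mpr (Or.inr (Or.inr e))).1
      · exact hPF hyP
  -- outsiders are singletons `{c}` (`c ∉ {a, b}`) or pairs
  have hout : ∀ y, y ∈ F → y ∉ P → (∃ c, y = {c} ∧ c ≠ a ∧ c ≠ b) ∨ y.card = 2 := by
    intro y hyF hyP
    have hy2 := hle2 y hyF
    rcases Nat.lt_or_ge y.card 2 with hlt | hge
    · left
      rcases Nat.lt_or_ge y.card 1 with h0 | h1
      · exfalso; apply hyP
        rw [Finset.card_eq_zero.mp (show y.card = 0 by omega), hPdef]; simp
      · obtain ⟨c, rfl⟩ := Finset.card_eq_one.mp (show y.card = 1 by omega)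
        refine ⟨c, rfl, fun e => hyP ?_, fun e => hyP ?_⟩
        · rw [e, hPdef]; simp
        · rw [e, hPdef]; simp
    · exact Or.inr (le_antisymm hy2 hge)
  -- an outside singleton lies in an outside pair
  have hsing_out : ∀ c : Fin h, ({c} : Finset (Fin h)) ∈ F → c ≠ a → c ≠ b →
      ∃ y, y ∈ F ∧ y ∉ P ∧ y.card = 2 ∧ c ∈ y := by
    intro c hc hca hcb
    obtain ⟨y, hyF, hcy, hy2⟩ := hpairOf c hc
    refine ⟨y, hyF, fun hyP => ?_, hy2, hcy⟩
    rw [hPmem] at hyP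
    rcases hyP with rfl | rfl | rfl | rfl
    · simp at hcy
    · simp at hy2
    · simp at hy2
    · simp only [Finset.mem_insert, Finset.mem_singleton] at hcy
      rcases hcy with e | e
      · exact hca e
      · exact hcb e
  -- an outside pair contains an element whose singleton is an outside singleton
  have hpair_out : ∀ y, y ∈ F → y ∉ P → y.card = 2 →
      ∃ c ∈ y, ({c} : Finset (Fin h)) ∈ F ∧ ({c} : Finset (Fin h)) ∉ P := by
    intro y hyF hyP hy2
    by_contra hno
    push Not at hno
    apply hyP
    have hsub : y ⊆ {a, b} := by
      intro c hc
      have hcF : ({c} : Finset (Fin h)) ∈ F := hlow y hyF _ (Finset.singleton_subset_iff.mpr hc)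
      rcases hsing c (hno c hc hcF) with rfl | rfl <;> simp
    rw [Finset.eq_of_subset_of_card_le hsub (by rw [Finset.card_pair hab, hy2]), hPdef]
    simp
  -- how to read off a member of `F`
  have hcases : ∀ y, y ∈ F → y = f ∨ y = g ∨ y = k ∨ y = ∅ ∨ y = {a} ∨ y = {b} ∨ y = {a, b} := by
    intro y hy
    rcases (hmemF y).mp hy with e | e | e | e
    · exact Or.inl e
    · exact Or.inr (Or.inl e)
    · exact Or.inr (Or.inr (Or.inl e))
    · exact Or.inr (Or.inr (Or.inr ((hPmem y).mp e)))
  have hfFP : f ∈ F ∧ f ∉ P := (hmemT f).mpr (Or.inl rfl)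
  have hgFP : g ∈ F ∧ g ∉ P := (hmemT g).mpr (Or.inr (Or.inl rfl))
  have hkFP : k ∈ F ∧ k ∉ P := (hmemT k).mpr (Or.inr (Or.inr rfl))
  have houts : ∀ y, y ∈ F → y ∉ P → y = f ∨ y = g ∨ y = k := fun y hy hyP => (hmemT y).mp ⟨hy, hyP⟩
  have haF : ({a} : Finset (Fin h)) ∈ F := hPF (by rw [hPmem]; simp)
  -- MATCHING CASE: outsiders `{c}`, `{d}` and one pair `q`
  have match_case : ∀ (c d : Fin h) (q : Finset (Fin h)), c ≠ a → c ≠ b → d ≠ a → d ≠ b → c ≠ d →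
      ({c} : Finset (Fin h)) ∈ F → ({d} : Finset (Fin h)) ∈ F → q.card = 2 →
      (∀ y, y ∈ F → y ∉ P → y = {c} ∨ y = {d} ∨ y = q) →
      (∃ a b c d : Fin h, a ≠ b ∧ a ≠ c ∧ a ≠ d ∧ b ≠ c ∧ b ≠ d ∧ c ≠ d ∧
        ({a} : Finset (Fin h)) ∈ F ∧ ({a, b} : Finset (Fin h)) ∈ F ∧
        ∀ y ∈ F, y = ∅ ∨ y = {a} ∨ y = {b} ∨ y = {c} ∨ y = {d} ∨ y = {a, b} ∨ y = {c, d}) := by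
    intro c d q hca hcb hda hdb hcd hcF hdF hq2 houts'
    -- the pair containing `c` (resp. `d`) is `q`
    have hmem_q : ∀ e : Fin h, ({e} : Finset (Fin h)) ∈ F → e ≠ a → e ≠ b → e ∈ q := by
      intro e heF hea heb
      obtain ⟨y, hyF, hyP, hy2, hey⟩ := hsing_out e heF hea heb
      rcases houts' y hyF hyP with rfl | rfl | rfl
      · simp at hy2
      · simp at hy2
      · exact hey
    have hq : q = {c, d} := by
      symm
      apply Finset.eq_of_subset_of_card_le
      · intro e he
        simp only [Finset.mem_insert, Finset.mem_singleton] at he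
        rcases he with rfl | rfl
        · exact hmem_q _ hcF hca hcb
        · exact hmem_q _ hdF hda hdb
      · rw [hq2, Finset.card_pair hcd]
    refine ⟨a, b, c, d, hab, fun e => hca e.symm, fun e => hda e.symm, fun e => hcb e.symm,
      fun e => hdb e.symm, hcd, haF, hxF, fun y hy => ?_⟩
    by_cases hyP : y ∈ P
    · rcases (hPmem y).mp hyP with e | e | e | e
      · exact Or.inl e
      · exact Or.inr (Or.inl e)
      · exact Or.inr (Or.inr (Or.inl e))
      · exact Or.inr (Or.inr (Or.inr (Or.inr (Or.inr (Or.inl e)))))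
    · rcases houts' y hy hyP with e | e | e
      · exact Or.inr (Or.inr (Or.inr (Or.inl e)))
      · exact Or.inr (Or.inr (Or.inr (Or.inr (Or.inl e))))
      · exact Or.inr (Or.inr (Or.inr (Or.inr (Or.inr (Or.inr (e.trans hq))))))
  -- KEY: given an outside singleton `s = {c}` and the other two outsiders `y₁`, `y₂`
  have key : ∀ s y₁ y₂ : Finset (Fin h), s ≠ y₁ → s ≠ y₂ → y₁ ≠ y₂ →
      s ∈ F ∧ s ∉ P → y₁ ∈ F ∧ y₁ ∉ P → y₂ ∈ F ∧ y₂ ∉ P →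
      (∀ y, y ∈ F → y ∉ P → y = s ∨ y = y₁ ∨ y = y₂) → ∀ c : Fin h, s = {c} →
      (∃ a b c d : Fin h, a ≠ b ∧ a ≠ c ∧ a ≠ d ∧ b ≠ c ∧ b ≠ d ∧ c ≠ d ∧
        ({a} : Finset (Fin h)) ∈ F ∧ ({a, b} : Finset (Fin h)) ∈ F ∧
        ∀ y ∈ F, y = ∅ ∨ y = {a} ∨ y = {b} ∨ y = {c} ∨ y = {d} ∨ y = {a, b} ∨ y = {c, d}) ∨
      (∃ a b c : Fin h, a ≠ b ∧ a ≠ c ∧ b ≠ c ∧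
        ∀ y ∈ F, y = ∅ ∨ y = {a} ∨ y = {b} ∨ y = {c} ∨ y = {a, b} ∨ y = {a, c} ∨ y = {b, c}) := by
    intro s y₁ y₂ hs1 hs2 h12 hsFP h1FP h2FP houts' c hsc
    have hca : c ≠ a := fun e => hsFP.2 (by rw [hsc, e, hPmem]; simp)
    have hcb : c ≠ b := fun e => hsFP.2 (by rw [hsc, e, hPmem]; simp)
    have hcF : ({c} : Finset (Fin h)) ∈ F := hsc ▸ hsFP.1
    rcases hout y₁ h1FP.1 h1FP.2 with ⟨d, h1d, hda, hdb⟩ | h12c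
    · rcases hout y₂ h2FP.1 h2FP.2 with ⟨e, h2e, hea, heb⟩ | h22c
      · -- three singletons: `c` lies in no outside pair
        exfalso
        obtain ⟨y, hyF, hyP, hy2, -⟩ := hsing_out c hcF hca hcb
        rcases houts' y hyF hyP with rfl | rfl | rfl
        · rw [hsc] at hy2; simp at hy2
        · rw [h1d] at hy2; simp at hy2
        · rw [h2e] at hy2; simp at hy2
      · -- `{c}`, `{d}`, pair `y₂`: matching
        left
        have hcd : c ≠ d := fun e => hs1 (by rw [hsc, h1d, e])
        exact match_case c d y₂ hca hcb hda hdb hcd hcF (h1d ▸ h1FP.1) h22c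
          (fun y hy hyP => by
            rcases houts' y hy hyP with e | e | e
            · exact Or.inl (e.trans hsc)
            · exact Or.inr (Or.inl (e.trans h1d))
            · exact Or.inr (Or.inr e))
    · rcases hout y₂ h2FP.1 h2FP.2 with ⟨e, h2e, hea, heb⟩ | h22c
      · -- `{c}`, pair `y₁`, `{e}`: matching
        left
        have hce : c ≠ e := fun e' => hs2 (by rw [hsc, h2e, e'])
        exact match_case c e y₁ hca hcb hea heb hce hcF (h2e ▸ h2FP.1) h12c
          (fun y hy hyP => by
            rcases houts' y hy hyP with e' | e' | e'
            · exact Or.inl (e'.trans hsc)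
            · exact Or.inr (Or.inr e')
            · exact Or.inr (Or.inl (e'.trans h2e)))
      · -- `{c}` and two pairs: triangle
        right
        -- both pairs contain `c`, their other element is `a` or `b`
        have hshape : ∀ q : Finset (Fin h), q ∈ F → q ∉ P → q.card = 2 → q ≠ s →
            (∀ y, y ∈ F → y ∉ P → y.card = 1 → y = s) →
            ∃ x : Fin h, (x = a ∨ x = b) ∧ q = {x, c} := by
          intro q hqF hqP hq2 hqs hsingles
          obtain ⟨c₁, hc₁q, hc₁F, hc₁P⟩ := hpair_out q hqF hqP hq2
          have hc₁ : c₁ = c := by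
            have := hsingles {c₁} hc₁F hc₁P (Finset.card_singleton c₁)
            rw [hsc] at this
            exact Finset.singleton_injective this
          subst hc₁
          obtain ⟨x, hx⟩ := Finset.card_eq_one.mp
            (show (q.erase c₁).card = 1 by rw [Finset.card_erase_of_mem hc₁q, hq2])
          have hxq : x ∈ q.erase c₁ := by rw [hx]; simp
          obtain ⟨hxc, hxq'⟩ := Finset.mem_erase.mp hxq
          have hxF : ({x} : Finset (Fin h)) ∈ F := hlow q hqF _ (Finset.singleton_subset_iff.mpr hxq')
          have hxab : x = a ∨ x = b := by
            by_cases hxP : ({x} : Finset (Fin h)) ∈ P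
            · exact hsing x hxP
            · exfalso
              have := hsingles {x} hxF hxP (Finset.card_singleton x)
              rw [hsc] at this
              exact hxc (Finset.singleton_injective this)
          refine ⟨x, hxab, ?_⟩
          rw [← Finset.insert_erase hc₁q, hx, Finset.pair_comm]
        have hsingles : ∀ y, y ∈ F → y ∉ P → y.card = 1 → y = s := by
          intro y hyF hyP hy1
          rcases houts' y hyF hyP with e | e | e
          · exact e
          · rw [e, h12c] at hy1; omega
          · rw [e, h22c] at hy1; omega
        obtain ⟨x₁, hx₁, hy₁⟩ := hshape y₁ h1FP.1 h1FP.2 h12c (fun e => hs1 e.symm) hsingles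
        obtain ⟨x₂, hx₂, hy₂⟩ := hshape y₂ h2FP.1 h2FP.2 h22c (fun e => hs2 e.symm) hsingles
        have hx12 : x₁ ≠ x₂ := fun e => h12 (by rw [hy₁, hy₂, e])
        -- read off the members
        have hall : ∀ y ∈ F, y = ∅ ∨ y = {a} ∨ y = {b} ∨ y = {c} ∨ y = {a, b} ∨
            y = {x₁, c} ∨ y = {x₂, c} := by
          intro y hy
          by_cases hyP : y ∈ P
          · rcases (hPmem y).mp hyP with e | e | e | e
            · exact Or.inl e
            · exact Or.inr (Or.inl e)
            · exact Or.inr (Or.inr (Or.inl e))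
            · exact Or.inr (Or.inr (Or.inr (Or.inr (Or.inl e))))
          · rcases houts' y hy hyP with e | e | e
            · exact Or.inr (Or.inr (Or.inr (Or.inl (e.trans hsc))))
            · exact Or.inr (Or.inr (Or.inr (Or.inr (Or.inr (Or.inl (e.trans hy₁))))))
            · exact Or.inr (Or.inr (Or.inr (Or.inr (Or.inr (Or.inr (e.trans hy₂))))))
        refine ⟨a, b, c, hab, fun e => hca e.symm, fun e => hcb e.symm, fun y hy => ?_⟩
        rcases hall y hy with e | e | e | e | e | e | e
        · exact Or.inl e
        · exact Or.inr (Or.inl e)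
        · exact Or.inr (Or.inr (Or.inl e))
        · exact Or.inr (Or.inr (Or.inr (Or.inl e)))
        · exact Or.inr (Or.inr (Or.inr (Or.inr (Or.inl e))))
        · rcases hx₁ with rfl | rfl
          · exact Or.inr (Or.inr (Or.inr (Or.inr (Or.inr (Or.inl e)))))
          · exact Or.inr (Or.inr (Or.inr (Or.inr (Or.inr (Or.inr e)))))
        · rcases hx₂ with rfl | rfl
          · exact Or.inr (Or.inr (Or.inr (Or.inr (Or.inr (Or.inl e)))))
          · exact Or.inr (Or.inr (Or.inr (Or.inr (Or.inr (Or.inr e)))))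
  -- find an outside singleton among f, g, k
  rcases hout f hfFP.1 hfFP.2 with ⟨c, hfc, -, -⟩ | hf2
  · exact key f g k hfg hfk hgk hfFP hgFP hkFP houts c hfc
  rcases hout g hgFP.1 hgFP.2 with ⟨c, hgc, -, -⟩ | hg2
  · exact key g f k (fun e => hfg e.symm) hgk hfk hgFP hfFP hkFP
      (fun y hy hyP => by rcases houts y hy hyP with e | e | e <;> simp [e]) c hgc
  rcases hout k hkFP.1 hkFP.2 with ⟨c, hkc, -, -⟩ | hk2
  · exact key k f g (fun e => hfk e.symm) (fun e => hgk e.symm) hfg hkFP hfFP hgFP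
      (fun y hy hyP => by rcases houts y hy hyP with e | e | e <;> simp [e]) c hkc
  -- three pairs: the outside singleton of `f` is missing
  exfalso
  obtain ⟨c, -, hcF, hcP⟩ := hpair_out f hfFP.1 hfFP.2 hf2
  rcases houts {c} hcF hcP with e | e | e
  · have := congrArg Finset.card e; rw [Finset.card_singleton, hf2] at this; omega
  · have := congrArg Finset.card e; rw [Finset.card_singleton, hg2] at this; omega
  · have := congrArg Finset.card e; rw [Finset.card_singleton, hk2] at this; omega

end Summit.ValiantsHypothesis.ValiantsHypothesis.Theorems.BarrierLever.FiniteCheck
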